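import Literature.AnabelianGeometry.EtaleTheta.Discharge.Sec2PiCHatSlimModelKrull
import Literature.AnabelianGeometry.EtaleTheta.Discharge.Sec2Cor29ModelKrull
import Literature.AnabelianGeometry.EtaleTheta.Discharge.Sec2PiCTemperedSide
import HarnessLib

/-!
# [EtTh] Prop. 2.6 (and Prop. 2.4) AS TYPED are FALSE at the κ′ cover datum (proof-only; question
# Q-L2t10g6-P26κ′ of the abc-iut L2 census, «decide `T.Prop26` at the κ′ cover datum»)

S. Mochizuki, *The étale theta function and its Frobenioid-theoretic manifestations*, Publ. RIMS **45** (2009)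
[EtTh], §2, Prop. 2.4 p. 38 («any automorphism of the topological group `Π^tp_{X̲̲}` … induces
automorphisms of `Π^tp_C`»), Prop. 2.6 p. 40 (the dotted version) [cite: MochizukiEtTh2009, Prop 2.6 p.40].
Cell abc-iut, layer L2, seat abc-iut-f-151 (gen 3). PROOF-ONLY (0 definitions, no instance, no new `Prop`).

THE DATUM. `T := (cLevelDataInvκ' p).temperedCoverData (toHatCκ p) …` — abc-iut-L2-d3's assembly of a
`ThetaCovers.TemperedCoverData l` at abc-iut-L2-t10's cusped untwisted Krull model `modelκ′`
(`Π^tp_C = (Γ ⋊_1 G_{ℚ_p}) ⋊_ι ℤ/2`, `Γ = F̂₂ ×_Ẑ ℤ`, `ι` the twisted inversion reversing the degree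
`ê : F̂₂ → Ẑ`), whose profinite completion is K4's `Π_C = (F̂₂ ⋊_1 G_{ℚ_p}) ⋊_{ι̂} ℤ/2` along `toHatCκ`
(abc-iut-L2-t10's K8 `exists_temperedCoverData_rmk261_cor29_inversionModelκ'` carries `T.Prop26 →` binders).

THE OBSTRUCTION (no Nielsen–Schreier / `U^ab` API is needed). Let `H ≤ Π^tp_X` be ANY open subgroup of
finite index of `Π^tp_C` (e.g. `Π^tp_{X̲̲}`, `Π^tp_{Ẋ̲̲}`). Some power `a^N` of the degree-`1` generator lies
in `H`, so the closure of `H` in `Π_C` contains `ĝ := a^{N·s}` for EVERY `s ∈ Ẑ`; conjugation by `ĝ` is a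
topological automorphism `γ` of `H` (the Galois action on `F̂₂` is trivial and `ê` is conjugation-invariant,
so `ĝ`-conjugation preserves the tempered `Π^tp_X`; `H = toHat⁻¹(cl H)`). If `γ` extended to a topological
automorphism `Γ′` of `Π^tp_C`, then — conjugating by the inversion `ε_±` and using the SLIMNESS of the
profinite `Π_C` (`isSlimGroup_PiCκ`) — `toHat(Γ′ ε_±) = ĝ ε̂_± ĝ⁻¹ = a^{N s}·σ̂(a^{N s})⁻¹·ε̂_± = a^{2 N s} ε̂_±`,
whose degree `(s^N)² ∈ Ẑ` must then be an INTEGER; `exists_pow_sq_ne_eta` produces `s` (a value of the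
cyclotomic character) for which it is not. Hence NO such `γ` extends (`exists_aut_not_extends_inversionModelκ'`),
so `T.Prop24` (member `X̲̲`) and `T.Prop26` (member `Ẋ̲̲`) FAIL at the κ′ cover datum for every choice of the
assembly's remaining binders (`not_prop24_…`, `not_prop26_…`; census form `exists_temperedCoverData_not_prop26_…`
in the shape of K8). So K8/K10/K11's conclusions `T.Prop26 → …` are VACUOUS at this datum.

HONEST FRAMING: SEMI-SYNTHETIC model (trivial Galois action; `Π^tp_C` of the MODEL, not of an orbicurve) —
this decides OUR typed one-object forms `TemperedCoverData.Prop24/Prop26` at ONE inhabitant only; refuted-at-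
a-model ≠ refuted-in-print (there Props 2.4/2.6 concern genuine tempered fundamental groups); FACT rows
F-0609/F-0610 are untouched as labels; nothing of [EtTh]/[SemiAnbd] is asserted or denied; no side is taken
on [IUTchIII] Cor. 3.12; typed ≠ proved; instantiated ≠ endorsed.
-/

noncomputable section

namespace Literature.AnabelianGeometry.EtaleTheta.SettingModel

open Literature.AnabelianGeometry.SemiGraphs ThetaCovers
open Literature.AlgebraicGeometry.Frobenioids (IsSlimGroup)
open _root_.Topology _root_.Function

variable (p : ℕ) [hp : Fact p.Prime]

/-! ## §1. The core: an automorphism of an open `H ≤ Π^tp_X` admitting NO extension to `Π^tp_C` -/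

/-- **No-extension lemma.** For every open finite-index subgroup `H ≤ Π^tp_X` of `Π^tp_C` (κ′ model) there is a
topological automorphism `γ` of `H` — conjugation by `ĝ = a^{N s} ∈ cl(H) ⊆ Π_C`, `(s^N)² ∉ ℤ` — that is the
restriction of NO topological automorphism of `Π^tp_C`. [cite: MochizukiEtTh2009, Prop 2.6 p.40] -/
theorem exists_aut_not_extends_inversionModelκ' (H : Subgroup (PiCInvκ p)) (hHo : IsOpen (H : Set (PiCInvκ p)))
    [H.FiniteIndex] (hHX : H ≤ (inclInvκ p).range) :
    ∃ γ : H ≃ₜ* H, ∀ Γ : PiCInvκ p ≃ₜ* PiCInvκ p, ¬ ∀ h : H, Γ h = γ h := by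
  classical
  have hιC := isProfiniteCompletion_toHatCκ p
  -- (1) a power of `a` in `H`
  let aκ : PiCInvκ p := inclInvκ p (SemidirectProduct.inl (gfpOf (FreeGroup.of 0)))
  have hN : H.normalCore.index ≠ 0 := Subgroup.FiniteIndex.index_ne_zero
  have haN : aκ ^ H.normalCore.index ∈ H := H.normalCore_le (Subgroup.pow_index_mem H.normalCore aκ)
  have hιa : toHatCκ p aκ = SemidirectProduct.inl (SemidirectProduct.inl (eta (FreeGroup.of 0))) := by
    rw [toHatCκ_inclInvκ]
    exact congrArg _ (SemidirectProduct.ext rfl rfl)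
  -- (2) the element `ĝ = inl (inl f)`, `f = a^{N s}`, in the closure of `H`
  obtain ⟨s, hs⟩ := exists_pow_sq_ne_eta p H.normalCore.index hN
  obtain ⟨A, hAk, hAe⟩ := exists_aPowHat
  set f : F₂hatT := A s ^ H.normalCore.index with hfdef
  have hef : eHat f = s ^ H.normalCore.index := by rw [hfdef, map_pow, hAe]
  set ĝ : PiCκ p := SemidirectProduct.inl (SemidirectProduct.inl f) with hĝdef
  have hĝmem : ĝ ∈ (H.map (toHatCκ p).toMonoidHom).topologicalClosure := by
    let Φ : ZH → PiCκ p := fun t =>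
      (SemidirectProduct.inl (SemidirectProduct.inl (A t)) : PiCκ p) ^ H.normalCore.index
    have hΦc : Continuous Φ := ((Semidirect.continuous_inl (isInducing_leftRightCκ p)).comp
      ((Semidirect.continuous_inl (isInducing_leftRightHatκ p)).comp A.continuous)).pow _
    have hΦι : Φ '' Set.range (iotaZ : Multiplicative ℤ → ZH) ⊆
        ((H.map (toHatCκ p).toMonoidHom : Subgroup (PiCκ p)) : Set (PiCκ p)) := by
      rintro _ ⟨_, ⟨k, rfl⟩, rfl⟩
      refine ⟨(aκ ^ H.normalCore.index) ^ Multiplicative.toAdd k, H.zpow_mem haN _, ?_⟩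
      show toHatCκ p ((aκ ^ H.normalCore.index) ^ Multiplicative.toAdd k) =
        (SemidirectProduct.inl (SemidirectProduct.inl (A (iotaZ k))) : PiCκ p) ^ H.normalCore.index
      rw [hAk]
      simp only [map_zpow, map_pow, hιa]
      rw [← zpow_natCast, ← zpow_natCast, ← zpow_mul, ← zpow_mul, mul_comm]
    have hsc : s ∈ closure (Set.range (iotaZ : Multiplicative ℤ → ZH)) := by
      rw [denseRange_iotaZ.closure_range]; trivial
    have h1 := closure_mono hΦι (image_closure_subset_closure_image hΦc ⟨s, hsc, rfl⟩)
    rw [← Subgroup.topologicalClosure_coe] at h1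
    have h2 : Φ s = ĝ := by
      show (SemidirectProduct.inl (SemidirectProduct.inl (A s)) : PiCκ p) ^ H.normalCore.index = ĝ
      rw [hĝdef, hfdef, map_pow, map_pow]
    rw [← h2]; exact h1
  -- (3) conjugation by `f` on `Π^tp_X` stabilises `H`
  obtain ⟨α, hα⟩ := exists_conjHatAut p f
  have hαs : ∀ x, toHatκ p (α.symm x) =
      (SemidirectProduct.inl f)⁻¹ * toHatκ p x * (SemidirectProduct.inl f)⁻¹⁻¹ := fun x => by
    have h := hα (α.symm x)
    rw [α.apply_symm_apply] at h
    rw [h, inv_inv]; group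
  have hHeq : ((H.map (toHatCκ p).toMonoidHom).topologicalClosure).comap (toHatCκ p).toMonoidHom = H :=
    IsProfiniteCompletion.comap_topologicalClosure_map hιC H hHo
  have hstab : ∀ (β : PiTpκ p ≃ₜ* PiTpκ p) (c : PiHtκ p),
      (SemidirectProduct.inl c : PiCκ p) ∈ (H.map (toHatCκ p).toMonoidHom).topologicalClosure →
      (∀ x, toHatκ p (β x) = c * toHatκ p x * c⁻¹) → ∀ x, inclInvκ p x ∈ H → inclInvκ p (β x) ∈ H := by
    intro β c hc hβ x hx
    rw [← hHeq, Subgroup.mem_comap]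
    change toHatCκ p (inclInvκ p (β x)) ∈ _
    rw [toHatCκ_inclInvκ, hβ, map_mul, map_mul, map_inv, ← toHatCκ_inclInvκ]
    exact Subgroup.mul_mem _ (Subgroup.mul_mem _ hc (Subgroup.le_topologicalClosure _ ⟨_, hx, rfl⟩))
      (Subgroup.inv_mem _ hc)
  have hleft : ∀ h ∈ H, inclInvκ p (SemidirectProduct.left h) = h := fun h hh => by
    obtain ⟨y, rfl⟩ := hHX hh; rfl
  have hright : ∀ h ∈ H, SemidirectProduct.right h = 1 := fun h hh => by rw [← hleft h hh]; rfl
  have hto : ∀ h ∈ H, inclInvκ p (α (SemidirectProduct.left h)) ∈ H := fun h hh =>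
    hstab α _ hĝmem hα _ (by rw [hleft h hh]; exact hh)
  have hinv : ∀ h ∈ H, inclInvκ p (α.symm (SemidirectProduct.left h)) ∈ H := fun h hh =>
    hstab α.symm _ (by rw [map_inv]; exact Subgroup.inv_mem _ hĝmem) hαs _ (by rw [hleft h hh]; exact hh)
  -- (4) the automorphism `γ` of `H`
  let γE : H ≃* H :=
    { toFun := fun h => ⟨inclInvκ p (α (SemidirectProduct.left (h : PiCInvκ p))), hto _ h.2⟩
      invFun := fun h => ⟨inclInvκ p (α.symm (SemidirectProduct.left (h : PiCInvκ p))), hinv _ h.2⟩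
      left_inv := fun h => Subtype.ext (by
        change inclInvκ p (α.symm (α (SemidirectProduct.left (h : PiCInvκ p)))) = h
        rw [α.symm_apply_apply, hleft _ h.2])
      right_inv := fun h => Subtype.ext (by
        change inclInvκ p (α (α.symm (SemidirectProduct.left (h : PiCInvκ p)))) = h
        rw [α.apply_symm_apply, hleft _ h.2])
      map_mul' := fun h k => Subtype.ext (by
        change inclInvκ p (α (SemidirectProduct.left ((h : PiCInvκ p) * (k : PiCInvκ p)))) =
          inclInvκ p (α (SemidirectProduct.left (h : PiCInvκ p))) *
            inclInvκ p (α (SemidirectProduct.left (k : PiCInvκ p)))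
        rw [← map_mul, ← map_mul, SemidirectProduct.mul_left, hright _ h.2, map_one, MulAut.one_apply]) }
  have hγc : Continuous γE := ((continuous_inclInvκ p).comp (α.continuous.comp
    ((Semidirect.continuous_left (isInducing_leftRightCInvκ p)).comp continuous_subtype_val))).subtype_mk _
  have hγc' : Continuous γE.symm := ((continuous_inclInvκ p).comp (α.symm.continuous.comp
    ((Semidirect.continuous_left (isInducing_leftRightCInvκ p)).comp continuous_subtype_val))).subtype_mk _
  refine ⟨ContinuousMulEquiv.mk γE hγc hγc', fun Γ hΓ => ?_⟩
  -- (5) an extension `Γ` is conjugation by `ĝ` on `toHat(H)` …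
  have hΓι : ∀ h ∈ H, toHatCκ p (Γ h) = ĝ * toHatCκ p h * ĝ⁻¹ := fun h hh => by
    have h1 := hΓ ⟨h, hh⟩
    change Γ h = inclInvκ p (α (SemidirectProduct.left h)) at h1
    rw [h1, toHatCκ_inclInvκ, hα, map_mul, map_mul, map_inv, ← toHatCκ_inclInvκ, hleft h hh]
  -- … hence `w := (ĝ ε̂)⁻¹ · toHat(Γ ε_±) · ĝ` centralises `toHat` of the open `K = H ∩ ε_±⁻¹ H ε_±`
  set ε : PiCInvκ p := epsPMInvκ p with hεdef
  set E : PiCκ p := toHatCκ p (Γ ε) with hEdef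
  set w : PiCκ p := (ĝ * toHatCκ p ε)⁻¹ * (E * ĝ) with hwdef
  let K : Subgroup (PiCInvκ p) := H ⊓ H.comap (MulAut.conj ε).toMonoidHom
  have hKo : IsOpen (K : Set (PiCInvκ p)) := by
    change IsOpen ((H : Set (PiCInvκ p)) ∩ (fun x => ε * x * ε⁻¹) ⁻¹' (H : Set (PiCInvκ p)))
    exact hHo.inter (hHo.preimage ((continuous_const.mul continuous_id).mul continuous_const))
  haveI : K.FiniteIndex := by
    refine Subgroup.finiteIndex_of_le (H := H.normalCore) (le_inf H.normalCore_le fun x hx => ?_)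
    exact H.normalCore_le (H.normalCore_normal.conj_mem x hx ε)
  have hkey : ∀ k ∈ K, toHatCκ p k * w = w * toHatCκ p k := by
    intro k hk
    have hkH : k ∈ H := hk.1
    have hkε : ε * k * ε⁻¹ ∈ H := hk.2
    have h1 := hΓι _ hkε
    simp only [map_mul, map_inv] at h1
    rw [hΓι k hkH, ← hEdef] at h1
    -- `h1 : E (ĝ k̂ ĝ⁻¹) E⁻¹ = ĝ (ε̂ k̂ ε̂⁻¹) ĝ⁻¹`
    have h2 : (E * ĝ) * toHatCκ p k * (E * ĝ)⁻¹ = (ĝ * toHatCκ p ε) * toHatCκ p k * (ĝ * toHatCκ p ε)⁻¹ := by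
      simpa only [mul_inv_rev, mul_assoc] using h1
    have h3 : (ĝ * toHatCκ p ε)⁻¹ * ((E * ĝ) * toHatCκ p k * (E * ĝ)⁻¹) * (E * ĝ) =
        (ĝ * toHatCκ p ε)⁻¹ * ((ĝ * toHatCκ p ε) * toHatCκ p k * (ĝ * toHatCκ p ε)⁻¹) * (E * ĝ) := by
      rw [h2]
    rw [hwdef]
    simpa only [mul_inv_rev, mul_assoc, inv_mul_cancel, mul_one, inv_mul_cancel_left] using h3.symm
  have hclo : IsOpen (((K.map (toHatCκ p).toMonoidHom).topologicalClosure : Subgroup (PiCκ p)) :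
      Set (PiCκ p)) :=
    IsProfiniteCompletion.isOpen_topologicalClosure_map hιC K hKo
  have hw : w ∈ Subgroup.centralizer
      (((K.map (toHatCκ p).toMonoidHom).topologicalClosure : Subgroup (PiCκ p)) : Set (PiCκ p)) := by
    rw [Subgroup.mem_centralizer_iff]
    intro g hg
    have hcl : IsClosed {g : PiCκ p | g * w = w * g} :=
      isClosed_eq (continuous_id.mul continuous_const) (continuous_const.mul continuous_id)
    have hsub : ((K.map (toHatCκ p).toMonoidHom : Subgroup (PiCκ p)) : Set (PiCκ p)) ⊆ {g | g * w = w * g} := by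
      rintro _ ⟨k, hk, rfl⟩; exact hkey k hk
    have hg' : g ∈ closure ((K.map (toHatCκ p).toMonoidHom : Subgroup (PiCκ p)) : Set (PiCκ p)) := by
      rwa [← Subgroup.topologicalClosure_coe]
    exact closure_minimal hsub hcl hg'
  rw [(isSlimGroup_PiCκ p).centralizer_eq_bot _ hclo, Subgroup.mem_bot, hwdef, inv_mul_eq_one] at hw
  -- (6) … so `toHat(Γ ε_±) = ĝ ε̂ ĝ⁻¹`, whose degree `(s^N)²` would be an integer
  have hE : E = ĝ * toHatCκ p ε * ĝ⁻¹ := by rw [eq_mul_inv_iff_mul_eq]; exact hw.symm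
  have hdeg : eHat ((E.left).left) =
      iotaZ ((SemidirectProduct.left (SemidirectProduct.left (Γ ε)) : Gfp).1.2) :=
    (mem_Gfp _).mp (SemidirectProduct.left (SemidirectProduct.left (Γ ε))).2
  rw [hE, hεdef, toHatCκ_epsPMInvκ, hĝdef] at hdeg
  simp only [SemidirectProduct.mul_left, SemidirectProduct.mul_right, SemidirectProduct.inv_left,
    SemidirectProduct.left_inl, SemidirectProduct.right_inl, SemidirectProduct.left_inr,
    SemidirectProduct.right_inr, map_one, MulAut.one_apply, inv_one, one_mul, mul_one,
    hatInvActionκ_ofAdd_one, hatInvκ_left, hatInvκ_right, map_mul, map_inv, eHat_sigmaHat, inv_inv, hef] at hdeg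
  rw [← sq, ← ofAdd_toAdd ((SemidirectProduct.left (SemidirectProduct.left (Γ ε)) : Gfp).1.2), iotaZ_ofAdd] at hdeg
  exact hs _ hdeg

/-! ## §2. At the κ′ cover datum: `T.Prop24` and `T.Prop26` FAIL -/

section CoverDatum

variable (op : (ThetaSetting.modelκ' p).OncePuncturedData) {l : ℕ} (hodd : Odd l)
  {x : (MuTwoSetting.inversionModelκ' p).Pt} (hx : (MuTwoSetting.inversionModelκ' p).IsCusp x)
  (hIx : (((cLevelDataInvκ' p).piCDataOf (toHatCκ p) (isProfiniteCompletion_toHatCκ p)).Dx x ⊓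
      ((cLevelDataInvκ' p).piCDataOf (toHatCκ p) (isProfiniteCompletion_toHatCκ p)).augGK.ker) ⊔
      ((cLevelDataInvκ' p).piCDataOf (toHatCκ p) (isProfiniteCompletion_toHatCκ p)).barKer l =
    ((cLevelDataInvκ' p).piCDataOf (toHatCκ p) (isProfiniteCompletion_toHatCκ p)).barTheta l)
  (hιell : ∀ c ∈ ((cLevelDataInvκ' p).piCDataOf (toHatCκ p) (isProfiniteCompletion_toHatCκ p)).augGK.ker,
    c ∉ ((cLevelDataInvκ' p).piCDataOf (toHatCκ p) (isProfiniteCompletion_toHatCκ p)).PiX →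
    ∀ d ∈ ((cLevelDataInvκ' p).piCDataOf (toHatCκ p) (isProfiniteCompletion_toHatCκ p)).PiX ⊓
      ((cLevelDataInvκ' p).piCDataOf (toHatCκ p) (isProfiniteCompletion_toHatCκ p)).augGK.ker,
      c * d * c⁻¹ * d ∈ ((cLevelDataInvκ' p).piCDataOf (toHatCκ p) (isProfiniteCompletion_toHatCκ p)).barTheta l)
  (hN : (((MuTwoSetting.inversionModelκ' p).GtpXu l).map (MuTwoSetting.inversionModelκ' p).inclX).Normal)
  (hY : ((MuTwoSetting.inversionModelκ' p).GtpY.map (MuTwoSetting.inversionModelκ' p).inclX).Normal)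
  {S : Subgroup (PiCκ p)}
  (hS : (((cLevelDataInvκ' p).piCDataOf (toHatCκ p) (isProfiniteCompletion_toHatCκ p)).coverDataAx l op hx hodd
    hIx hιell (((cLevelDataInvκ' p).piCDataOf (toHatCκ p) (isProfiniteCompletion_toHatCκ p)).inv_theta_of_inv_ell
      l op hιell)).toCoverData.IsSplitting S)
  (hSc : IsClosed (S : Set (PiCκ p)))

/-- At the κ′ cover datum, `Π^tp_{X̲̲}` and `Π^tp_{Ẋ̲̲}` are open finite-index subgroups of `Π^tp_C` contained in
`Π^tp_X` — the hypotheses of the no-extension lemma. [cite: MochizukiEtTh2009, Prop 2.4 p.38] -/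
theorem tp_PiXuu_hyps_inversionModelκ' :
    let T := (cLevelDataInvκ' p).temperedCoverData (toHatCκ p) (isProfiniteCompletion_toHatCκ p)
      (toHatCκ_injective p) op hodd hx hIx hιell hN hY hS hSc
    let Z : Subgroup (PiCInvκ p) := T.tp T.PiXuu
    let D : Subgroup (PiCInvκ p) := T.PiCdot
    IsOpen (Z : Set (PiCInvκ p)) ∧ Z.FiniteIndex ∧ Z ≤ (inclInvκ p).range ∧
      IsOpen ((Z ⊓ D : Subgroup (PiCInvκ p)) : Set (PiCInvκ p)) ∧ (Z ⊓ D).FiniteIndex := by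
  intro T Z D
  let I := (cLevelDataInvκ' p).piCDataOf (toHatCκ p) (isProfiniteCompletion_toHatCκ p)
  let Cuu : Subgroup (PiCκ p) := T.PiCuu
  let W : Subgroup (PiCκ p) := T.PiXuu
  have hW : W = Cuu ⊓ I.PiX := rfl
  have hCuu : IsOpen (Cuu : Set (PiCκ p)) := T.isOpen_PiCuu'
  have hopen : IsOpen (W : Set (PiCκ p)) := by
    rw [hW, Subgroup.coe_inf]
    exact hCuu.inter I.isOpen_PiX
  have ho : IsOpen (Z : Set (PiCInvκ p)) := hopen.preimage (toHatCκ p).continuous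
  haveI : Finite (PiCκ p ⧸ W) := W.quotient_finite_of_isOpen hopen
  haveI : W.FiniteIndex := Subgroup.finiteIndex_of_finite_quotient
  haveI hfi : Z.FiniteIndex := ⟨by
    change (W.comap (toHatCκ p).toMonoidHom).index ≠ 0
    rw [Subgroup.index_comap_of_denseRange (toHatCκ p).toMonoidHom
      (isProfiniteCompletion_toHatCκ p).denseRange _ hopen]
    exact Subgroup.FiniteIndex.index_ne_zero⟩
  haveI : D.FiniteIndex := ⟨ne_of_eq_of_ne T.index_PiCdot (by norm_num)⟩
  have hle : Z ≤ (inclInvκ p).range := fun g hg => by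
    have hg' : toHatCκ p g ∈ Cuu ⊓ I.PiX := hg
    exact (MuTwoSetting.CLevelData.mem_range_hatInclX_iff (toHatCκ p) (isProfiniteCompletion_toHatCκ p) I.incl
      ((cLevelDataInvκ' p).piCDataOf_incl_toHat (toHatCκ p) (isProfiniteCompletion_toHatCκ p)) g).mp
      (Subgroup.mem_inf.mp hg').2
  refine ⟨ho, hfi, hle, ?_, inferInstance⟩
  rw [Subgroup.coe_inf]
  exact ho.inter T.isOpen_PiCdot

/-- **[EtTh] Prop. 2.6 AS TYPED (`TemperedCoverData.Prop26`) FAILS at the κ′ cover datum**, for every choice of the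
assembly's binders: the no-extension automorphism of `Π^tp_{Ẋ̲̲} = Π^tp_{X̲̲} ∩ Π^tp_Ċ` (first member of the list).
SEMI-SYNTHETIC model; a statement about OUR typing; nothing of [EtTh] asserted or denied. [cite: MochizukiEtTh2009, Prop 2.6 p.40] -/
theorem not_prop26_temperedCoverData_inversionModelκ' :
    ¬ ((cLevelDataInvκ' p).temperedCoverData (toHatCκ p) (isProfiniteCompletion_toHatCκ p)
      (toHatCκ_injective p) op hodd hx hIx hιell hN hY hS hSc).Prop26 := by
  intro h26
  obtain ⟨-, -, hle, ho, hfi⟩ := tp_PiXuu_hyps_inversionModelκ' p op hodd hx hIx hιell hN hY hS hSc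
  set T := (cLevelDataInvκ' p).temperedCoverData (toHatCκ p) (isProfiniteCompletion_toHatCκ p)
    (toHatCκ_injective p) op hodd hx hIx hιell hN hY hS hSc with hT
  haveI := hfi
  obtain ⟨γ, hγ⟩ := exists_aut_not_extends_inversionModelκ' p _ ho (inf_le_left.trans hle)
  obtain ⟨Γ, hΓ, -⟩ := h26 (T.tp T.PiXuu) (by simp) γ
  exact hγ Γ hΓ

/-- **[EtTh] Prop. 2.4 AS TYPED (`TemperedCoverData.Prop24`) FAILS at the κ′ cover datum** (same automorphism, on
`Π^tp_{X̲̲}`; the obstruction is the C-level inversion `ε_±`, so the X-level extension statements are untouched).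
SEMI-SYNTHETIC model; a statement about OUR typing only. [cite: MochizukiEtTh2009, Prop 2.4 p.38] -/
theorem not_prop24_temperedCoverData_inversionModelκ' :
    ¬ ((cLevelDataInvκ' p).temperedCoverData (toHatCκ p) (isProfiniteCompletion_toHatCκ p)
      (toHatCκ_injective p) op hodd hx hIx hιell hN hY hS hSc).Prop24 := by
  intro h24
  obtain ⟨ho, hfi, hle, -, -⟩ := tp_PiXuu_hyps_inversionModelκ' p op hodd hx hIx hιell hN hY hS hSc
  haveI := hfi
  obtain ⟨γ, hγ⟩ := exists_aut_not_extends_inversionModelκ' p _ ho hle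
  obtain ⟨Γ, hΓ, -⟩ := h24.1 γ
  exact hγ Γ hΓ

end CoverDatum

/-- **Census form** (the shape of abc-iut-L2-t10's K8 `exists_temperedCoverData_rmk261_cor29_inversionModelκ'`, SAME
assembly): for every odd `l` and once-punctured parameters `eX` of `modelκ′`, the κ′ cover datum of record —
profinite part = the DERIVED `coverDataAx` on `PiCκ p` — has `¬ T.Prop26 ∧ ¬ T.Prop24`; so the K8/K10/K11
conclusions `T.Prop26 → …` are VACUOUS at this datum. [cite: MochizukiEtTh2009, Prop 2.6 p.40] -/
theorem exists_temperedCoverData_not_prop26_inversionModelκ' {l : ℕ} (hodd : Odd l)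
    (eX : (ThetaSetting.modelκ' p).OncePuncturedData) :
    ∃ T : TemperedCoverData.{0} l,
      T.toCoverDataAx = ((cLevelDataInvκ' p).piCDataOf (toHatCκ p) (isProfiniteCompletion_toHatCκ p)).coverDataAx l eX
        (x := ()) trivial hodd (hIx_piCDataOf_toHatCκ p l hodd.pos eX ())
        (inv_ell_piCDataOf_toHatCκ p l eX) (inv_theta_piCDataOf_toHatCκ p l eX) ∧
      ¬ T.Prop26 ∧ ¬ T.Prop24 := by
  obtain ⟨s, hs, hsa, hsc⟩ := (cuspLaws_modelκ' p).exists_section (x := ()) trivial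
  exact ⟨_, (cLevelDataInvκ' p).temperedCoverData_toCoverDataAx (toHatCκ p) (isProfiniteCompletion_toHatCκ p)
      (toHatCκ_injective p) eX hodd trivial _ (inv_ell_piCDataOf_toHatCκ p l eX)
      ((cLevelDataInvκ' p).map_inclX_GtpXu_normal l (kerToZIsCompactlyGenerated_modelκ' p))
      ((cLevelDataInvκ' p).map_inclX_GtpY_normal (kerToZIsCompactlyGenerated_modelκ' p))
      (((cLevelDataInvκ' p).piCDataOf (toHatCκ p) (isProfiniteCompletion_toHatCκ p)).isSplitting_of_section l eX
        (x := ()) trivial hodd _ (inv_ell_piCDataOf_toHatCκ p l eX) _ s hs hsa)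
      (((cLevelDataInvκ' p).piCDataOf (toHatCκ p) (isProfiniteCompletion_toHatCκ p)).isClosed_splittingOfSection
        l eX s hsc),
    not_prop26_temperedCoverData_inversionModelκ' p eX hodd trivial _ _ _ _ _ _,
    not_prop24_temperedCoverData_inversionModelκ' p eX hodd trivial _ _ _ _ _ _⟩

end Literature.AnabelianGeometry.EtaleTheta.SettingModel

end
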